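import Literature.MathematicalPhysics.QuantumFieldTheory.Balaban1983to89.B9Eq3132FacesAtLettersR
import Literature.MathematicalPhysics.QuantumFieldTheory.Balaban1983to89.B9Thm312WholeStepRegular
import Literature.MathematicalPhysics.QuantumFieldTheory.Balaban1983to89.B9Thm312WholeClasses

/-!
# `Balaban1983to89.B9Eq3132FromStateR` — T. Bałaban, *Propagators for lattice gauge theories in a background field*, Commun. Math. Phys. **99** (1985)
# 389–434 [Balaban1985BackgroundPropagators], (3.132) p. 422 under Theorem 3.12's prefix p. 423: ROW 26 OF THE N06 CERTIFICATE FROM THE STEP OVER A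
# REGULAR STATE CLASS 𝔖 (instead of the raw sup-class step) — the [4]-(2.51) majorants of G, G₁, G − G₀, G₁ − G₀ and the `s3132` face

[4] = T. Bałaban, *Propagators and renormalization transformations for lattice gauge theories. II*, Commun. Math. Phys. **96** (1984) 223–250 [`Balaban1984PropagatorsII`].

statement-level skeleton of published theorems with citation tags; proofs where landed; nothing here is a claim about the Yang–Mills mass gap

THE PRINT.  [B9] p. 422: the Neumann series (3.130) G′ = Σ (G₀Δ′_π)ⁿG₀ and (3.138) G₁ = Σ (G₀(Δ′_π + Δ⁽²⁾_π))ⁿG₀ converge *«in all norms appearing on the left-hand sides of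
(3.42)–(3.47)»*, whence *«|(QG̃Q*)⁻¹(U; y, y′)|, |(QG₁Q*)⁻¹(U; y, y′)| ≦ O(1)(Lʲη)⁻²(L^{j′}η)^{−d} exp(−δ d(y, y′)) (3.132)»*; [4] (2.51)–(2.54) pp. 232–233
(block majorants compose; a summation preserves them), Lemma 2.1 (2.61) p. 234 (the row sum).

WHY THIS FILE (dag-n06-d g18, the U8 cure, director-ym №272 (5)).  The certificate of record derives ROW 26 ((3.132)) through
`B9Eq3132FacesAtLettersR.s3132Nu_opsYSectE_of_step12_R_of_refinesY`, whose input `hmodel` carries the steps `Step (𝔬 x) 1 H 1∕2 (θ₁·Mα₀) δK U` on the RAW sup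
classes 𝔠⁽¹⁾, 𝔠⁽²⁾ — for the second perturbation `G₀(Δ′_π + Δ⁽²⁾_π)` these rest on the raw Δ⁽²⁾ letters `hta₂ ∕ htb₂` located by the referees (LOCATED-U8: NOT a printed
species).  Print's (3.138) is a statement over the REGULAR STATE (all the norms (3.42)–(3.47) at once); dag-n06-l's `B9Thm312WholeStepRegular.StepS 𝔬 𝔖 θ δK U` is that
step, and its right-entry glue (`hasMaj_right_of_stepS`, `hasMaj_read_of_state`, `exists_hasMaj_const_of_dom`) gives the (2.51) entries of G and G₁ OUT OF 𝔠⁽⁰⁾ INTO 𝔖 and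
then, through the sup reading `id : 𝔖 → 𝔠^{(−2)}`, back in the raw shape `C·(Lʲη)²·e^{−δd}` that ROW 26's transfers (`B9Eq3132DecayFromMajorantR.decayUnder_QGQOfY_of_majorants_R`,
`B9Eq3132CoerciveFromGAR.coerciveUnder_of_subMajorants_R`) consume.  THIS FILE is that re-routing: §1 one member (the four majorants from `StepS` + the producer
`G₀ : 𝔠⁽⁰⁾ → 𝔖` + the reading + the ℓ¹-domination of 𝔖 + the identities + (2.61)); §2 the families `majorants_of_stepS_R` ∕ `subMajorants_of_stepS_R` with the SAME
conclusions as `majorants_of_step12_R` ∕ `subMajorants_of_step12_R`; §3 ROW 26's faces `hdec26_of_stepS_of_R`, `hco26_of_refinesY_stepS_of_R` and ★★★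
`s3132Nu_opsYSectE_of_stepS_R_of_refinesY` — the twins of `B9Eq3132FacesAtLettersR` §3–§5 with `hmodel` replaced by the STATE TUPLE `hstate` (the `StepS`, producer, reading,
`κ ≤ κ_S`, ℓ¹ conjuncts of the S-leaves' `hstate2` at 𝔖₂, plus `Identities`).  Everything else is the existing machinery BY NAME.
HONEST LABEL: port of printed (3.130)∕(3.138) ⇒ (3.132) bookkeeping over hypothesis schemas of printed species; count-neutral; N06 NOT discharged; nothing continuum ∕ OS ∕ mass gap.
Cell `pub-ymgap` (HUMAN RULING D-0062), Track A node N06 [B9], seat `pub-ymgap-dag-n06-d` (g18), 2026-08-29.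
-/

noncomputable section

namespace Literature.MathematicalPhysics.QuantumFieldTheory.Balaban1983to89.B9Eq3132FromStateR

open Node00
open B6RandomWalk (HasMajorant hasMajorant_mono Triangle254)
open B6RandomWalkHom (HasMajorantHom hasMajorantHom_iff)
open B6GlobalChartV1 (blkV1)
open B6Ineq2142KLevelV1 (lvl β)
open B9Thm34Ext (toB6)
open B11SectG (RowSum HasMaj BlockNorm hasMaj_comp_exp)
open B9Thm312Whole (Ops Identities GeoOK cNorm)
open B9Thm312WholeClasses (cNormR cNormR_loc hasMajorantHom_of_hasMaj_cNormR)
open B9Thm312WholeLeaf (fix_of_inverses)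
open B9Thm312WholeStepRegular (StepS hasMaj_right_of_stepS hasMaj_read_of_state exists_hasMaj_const_of_dom)
open B9SectDSup (weightNorm_loc)
open B9PinMembersKLevelV1 (MemberY geo9Y)
open B9BackgroundsKLevelV1R (RegFamY bg9YR regY335 regY336 siteKernelR MemOfFam)
open B7Prop2SpecialUnitary (specialUnitaryUnits specialUnitaryUnits_le_unitaryUnits)
open B9Ineq349SiteFromConv342 (contractive_of_mem)
open B9CoReadingCoords (XBK blkBK GcoK)
open B9CoReadingCoordsTranspose (TrIdx trBasis)
open B9Thm311ReadingCoords (trIP PosDefTr)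
open B9RWSumsReadsNbr (nbr)
open B9GeoLemma21KLevelV1 (rowSum261_geo9Y)
open B9Eq3132RingInverseReading (normMatY)
open B9Eq3132NuReading (lamInvY nuY siteKernelOfOpNu opsYS349NuOfLetters)
open B9Eq3132CTInputs (CoerciveUnder DecayUnder)
open B9Eq3132ScalarIndex (geoComap)
open B9Eq3132StepDifference (GcoK_sub)
open B9Eq3132DecayFromMajorantR (decayUnder_QGQOfY_of_majorants_R)
open B9Eq3132CoerciveFromGAR (coerciveUnder_of_subMajorants_R)
open B9Eq3132CoerciveFromEnergyR (hcoA_of_refinesY_R)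
open B9Eq3132FacesAtLettersR (hdec26_of_majorants_of_R s3132Nu_opsYSectE_of_ringInverse_R)
open scoped Matrix.Norms.L2Operator

/-! ## §1 One member: the four [4]-(2.51) majorants from the step over a regular state -/

section OneMember

variable {g : B9.Geometry} {B : B9.Backgrounds} {X Y Z W : Type} [Fintype X] [Fintype Y] [Fintype Z] [Fintype W] [Fintype g.Site]

omit [Fintype Y] [Fintype Z] [Fintype W] in
/-- Source side: a majorant out of 𝔠⁽⁰⁾ (integer weight) is the same majorant out of 𝔠^{(0)} (real weight (Lʲη)⁰). [cite: Balaban1985BackgroundPropagators, (3.42) p.397 (bookkeeping)] -/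
theorem hasMaj_src_zero_toR {R₀ : ℝ} {H₀ : Prop} (hG : GeoOK g) {F : Type} [AddCommGroup F] [Module ℝ F] {blk : X → g.Site}
    {b₂ : BlockNorm (toB6 g R₀ H₀) F} {T : (X → ℝ) →ₗ[ℝ] F} {K : g.Site → g.Site → ℝ}
    (h : HasMaj (cNorm R₀ H₀ blk hG.lenle 0) b₂ T K) : HasMaj (cNormR R₀ H₀ blk hG.lenle 0) b₂ T K := by
  intro y' μ hμ y
  have hb := h y' μ hμ y
  rw [show (cNorm R₀ H₀ blk hG.lenle 0).loc y' μ = (BlockNorm.ofBlocks (toB6 g R₀ H₀) blk).loc y' μ from by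
    simp only [cNorm, weightNorm_loc, B9Thm312Whole.wt, pow_zero, inv_one, one_mul]] at hb
  rw [cNormR_loc blk hG.lenle (0 : ℝ) y' μ, Real.rpow_zero, one_mul]
  exact hb

omit [Fintype Y] [Fintype Z] [Fintype W] in
/-- **A RIGHT ENTRY READ BACK IN THE RAW SHAPE**: an operator `A : 𝔠⁽⁰⁾ → 𝔠^{(−2)}` with majorant `K ≥ 0` has the [4]-(2.51) majorant `K·(Lʲη)²` on the sharp blocks.
[cite: Balaban1984PropagatorsII, (2.51) p.232; Balaban1985BackgroundPropagators, (3.42) p.397] -/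
theorem hasMajorant_of_read {R₀ : ℝ} {H₀ : Prop} (hG : GeoOK g) {blk : X → g.Site} {A : Module.End ℝ (X → ℝ)} {C ρ : ℝ} (hC : 0 ≤ C)
    (h : HasMaj (cNorm R₀ H₀ blk hG.lenle 0) (cNormR R₀ H₀ blk hG.lenle (-2)) A (fun a b => C * Real.exp (-(ρ * g.dist a b)))) :
    HasMajorant (g := toB6 g R₀ H₀) blk A (fun a b => C * g.len a ^ 2 * Real.exp (-(ρ * g.dist a b))) := by
  have h' := hasMajorantHom_of_hasMaj_cNormR hG (fun a b => mul_nonneg hC (Real.exp_nonneg _)) (hasMaj_src_zero_toR hG h)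
  rw [hasMajorantHom_iff] at h'
  refine hasMajorant_mono (g := toB6 g R₀ H₀) blk h' fun a b => le_of_eq ?_
  rw [neg_neg, Real.rpow_zero, mul_one, Real.rpow_two]
  ring

omit [Fintype Y] in
/-- ★ **THE (2.51) MAJORANTS OF `G`, `G₁`, `G − G₀`, `G₁ − G₀` FROM THE STEP OVER A REGULAR STATE** (one member, one `U`): the step `StepS 𝔬 𝔖 θ δK U` (BOTH perturbations,
(3.130)∕(3.138) read on 𝔖), the producer `G₀ : 𝔠⁽⁰⁾ → 𝔖` (A₀e^{−δ_P d}), the sup reading `id : 𝔖 → 𝔠^{(−2)}` (C_Re^{−δ_P d}), the size `κ_𝔖 ≦ κ_S`, the ℓ¹-domination of 𝔖 (for the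
a-priori majorants), the identities (resolvent forms of G, G₁), the row sum (2.61) at σ with constant c and the smallness κ_Sθc ≦ ½ give, at any rate δ ≧ 0 with δ + 2σ ≦ δ_K,
δ + σ ≦ δ_P: the entries `2κ_S C_R A₀ c·(Lʲη)²e^{−δd}` of G and G₁ and the differences `2κ_S² C_R A₀ c²·θ·(Lʲη)²e^{−δd}` of G − G₀, G₁ − G₀ (the small factor θ survives).
[cite: Balaban1985BackgroundPropagators, (3.130) p.421, (3.138) p.423, (3.132) p.422, Thm 3.12 p.423; Balaban1984PropagatorsII, (2.51)–(2.54) pp.232–233, Lemma 2.1 (2.61) p.234] -/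
theorem hasMajorant_entries_of_stepS {R₀ : ℝ} {H₀ : Prop} (hG : GeoOK g) (𝔬 : Ops g B X Y Z W) {U : B.Cfg} {𝔖 : BlockNorm (toB6 g R₀ H₀) (X → ℝ)}
    {θ A₀ CR κS δK δP δ σ c Λ : ℝ} (hrow : RowSum (toB6 g R₀ H₀) σ c)
    (hθ : 0 ≤ θ) (hA₀ : 0 ≤ A₀) (hCR : 0 ≤ CR) (hκS : 0 ≤ κS) (hδ : 0 ≤ δ) (hδK : δ + 2 * σ ≤ δK) (hδP : δ + σ ≤ δP) (hσ : 0 ≤ σ) (hc : 0 ≤ c) (hq : κS * θ * c ≤ 1 / 2)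
    (hS : StepS 𝔬 𝔖 θ δK U)
    (hP : HasMaj (cNorm R₀ H₀ 𝔬.blk hG.lenle 0) 𝔖 (𝔬.G0 U) (fun a b => A₀ * Real.exp (-(δP * g.dist a b))))
    (hRd : HasMaj 𝔖 (cNormR R₀ H₀ 𝔬.blk hG.lenle (-2)) LinearMap.id (fun a b => CR * Real.exp (-(δP * g.dist a b))))
    (hκ : 𝔖.κ ≤ κS) (hΛ : 0 ≤ Λ) (hdom : ∀ (y : g.Site) (F : X → ℝ), 𝔖.loc y F ≤ Λ * ∑ x : X, |F x|) (hI : Identities 𝔬 U) :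
    HasMajorant (g := toB6 g R₀ H₀) 𝔬.blk (𝔬.G U) (fun a b => 2 * κS * CR * A₀ * c * g.len a ^ 2 * Real.exp (-(δ * g.dist a b))) ∧
      HasMajorant (g := toB6 g R₀ H₀) 𝔬.blk (𝔬.G1 U) (fun a b => 2 * κS * CR * A₀ * c * g.len a ^ 2 * Real.exp (-(δ * g.dist a b))) ∧
      HasMajorant (g := toB6 g R₀ H₀) 𝔬.blk (𝔬.G U - 𝔬.G0 U) (fun a b => 2 * κS * κS * CR * A₀ * c * c * θ * g.len a ^ 2 * Real.exp (-(δ * g.dist a b))) ∧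
      HasMajorant (g := toB6 g R₀ H₀) 𝔬.blk (𝔬.G1 U - 𝔬.G0 U) (fun a b => 2 * κS * κS * CR * A₀ * c * c * θ * g.len a ^ 2 * Real.exp (-(δ * g.dist a b))) := by
  have htri : Triangle254 (toB6 g R₀ H₀) := fun a b c => hG.tri a b c
  have hκ0 : 0 ≤ 𝔖.κ := 𝔖.κ_nonneg
  have hq' : 𝔖.κ * θ * c ≤ 1 / 2 := (mul_le_mul_of_nonneg_right (mul_le_mul_of_nonneg_right hκ hθ) hc).trans hq
  have hq1 : 𝔖.κ * θ * c < 1 := lt_of_le_of_lt hq' (by norm_num)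
  have hinv : (1 - 𝔖.κ * θ * c)⁻¹ ≤ 2 := by rw [inv_le_comm₀ (by linarith) (by norm_num)]; linarith
  have hinv0 : 0 ≤ (1 - 𝔖.κ * θ * c)⁻¹ := inv_nonneg.mpr (by linarith)
  -- the producer as a right factor `G₀ ∘ id`
  have hP' : HasMaj (cNorm R₀ H₀ 𝔬.blk hG.lenle 0) 𝔖 (𝔬.G0 U ∘ₗ LinearMap.id) (fun a b => A₀ * Real.exp (-(δP * g.dist a b))) := by
    rw [LinearMap.comp_id]; exact hP
  -- resolvent identities and a-priori majorants
  have hfix : 𝔬.G U = 𝔬.G0 U + 𝔬.G0 U ∘ₗ 𝔬.Tpi U ∘ₗ 𝔬.G U := fix_of_inverses hI.invG0' hI.invG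
  have hfix1 : 𝔬.G1 U = 𝔬.G0 U + 𝔬.G0 U ∘ₗ (𝔬.Tpi U + 𝔬.T2 U) ∘ₗ 𝔬.G1 U := fix_of_inverses hI.invG0' hI.invG1
  obtain ⟨M₀, hM₀, hap⟩ := exists_hasMaj_const_of_dom hG 𝔬.blk 𝔬.blk 0 hΛ hdom (𝔬.G U ∘ₗ LinearMap.id)
  obtain ⟨M₁, hM₁, hap1⟩ := exists_hasMaj_const_of_dom hG 𝔬.blk 𝔬.blk 0 hΛ hdom (𝔬.G1 U ∘ₗ LinearMap.id)
  -- the entries INTO 𝔖 at rate δ + σ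
  have hE := hasMaj_right_of_stepS hG (A := 𝔬.G U) (Fop := LinearMap.id) hrow hθ hA₀ hM₀ (ρ := δ + σ) (by linarith) (by linarith : δ + σ ≤ δP)
    (by linarith : δ + σ + σ ≤ δK) hS.step hP' hfix hap hq1
  have hE1 := hasMaj_right_of_stepS hG (A := 𝔬.G1 U) (Fop := LinearMap.id) hrow hθ hA₀ hM₁ (ρ := δ + σ) (by linarith) (by linarith : δ + σ ≤ δP)
    (by linarith : δ + σ + σ ≤ δK) hS.step1 hP' hfix1 hap1 hq1
  have hA' : 0 ≤ A₀ * (1 - 𝔖.κ * θ * c)⁻¹ := mul_nonneg hA₀ hinv0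
  -- read into 𝔠^{(−2)} at rate δ, then back to the raw shape
  have hR := hasMaj_read_of_state hG hrow hA' hCR hδ (by linarith : δ ≤ δ + σ) hδP hE hRd
  have hR1 := hasMaj_read_of_state hG hrow hA' hCR hδ (by linarith : δ ≤ δ + σ) hδP hE1 hRd
  rw [LinearMap.comp_id, LinearMap.id_comp] at hR hR1
  have hCn : 0 ≤ 𝔖.κ * CR * (A₀ * (1 - 𝔖.κ * θ * c)⁻¹) * c := by positivity
  have hG' := hasMajorant_of_read hG hCn hR
  have hG1' := hasMajorant_of_read hG hCn hR1
  -- the differences: `A − G₀ = (G₀T) ∘ A`, composed INSIDE 𝔖 then read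
  have hsub : 𝔬.G U - 𝔬.G0 U = (𝔬.G0 U ∘ₗ 𝔬.Tpi U) ∘ₗ (𝔬.G U ∘ₗ LinearMap.id) := by
    rw [LinearMap.comp_id]; conv_lhs => rw [hfix]
    rw [add_sub_cancel_left, LinearMap.comp_assoc]
  have hsub1 : 𝔬.G1 U - 𝔬.G0 U = (𝔬.G0 U ∘ₗ (𝔬.Tpi U + 𝔬.T2 U)) ∘ₗ (𝔬.G1 U ∘ₗ LinearMap.id) := by
    rw [LinearMap.comp_id]; conv_lhs => rw [hfix1]
    rw [add_sub_cancel_left, LinearMap.comp_assoc]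
  have hD := hasMaj_comp_exp (b₁ := cNorm R₀ H₀ 𝔬.blk hG.lenle 0) (b₂ := 𝔖) (b₃ := 𝔖) (T₁ := 𝔬.G0 U ∘ₗ 𝔬.Tpi U) (T₂ := 𝔬.G U ∘ₗ LinearMap.id)
    htri hG.dnn hrow hθ hA' (by linarith : 0 ≤ δ + σ) (le_rfl : δ + σ ≤ δ + σ) (by linarith : δ + σ + σ ≤ δK) hS.step hE
  have hD1 := hasMaj_comp_exp (b₁ := cNorm R₀ H₀ 𝔬.blk hG.lenle 0) (b₂ := 𝔖) (b₃ := 𝔖) (T₁ := 𝔬.G0 U ∘ₗ (𝔬.Tpi U + 𝔬.T2 U)) (T₂ := 𝔬.G1 U ∘ₗ LinearMap.id)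
    htri hG.dnn hrow hθ hA' (by linarith : 0 ≤ δ + σ) (le_rfl : δ + σ ≤ δ + σ) (by linarith : δ + σ + σ ≤ δK) hS.step1 hE1
  have hA'' : 0 ≤ 𝔖.κ * θ * (A₀ * (1 - 𝔖.κ * θ * c)⁻¹) * c := by positivity
  have hRD := hasMaj_read_of_state hG hrow hA'' hCR hδ (by linarith : δ ≤ δ + σ) hδP hD hRd
  have hRD1 := hasMaj_read_of_state hG hrow hA'' hCR hδ (by linarith : δ ≤ δ + σ) hδP hD1 hRd
  rw [LinearMap.id_comp, ← hsub] at hRD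
  rw [LinearMap.id_comp, ← hsub1] at hRD1
  have hCn' : 0 ≤ 𝔖.κ * CR * (𝔖.κ * θ * (A₀ * (1 - 𝔖.κ * θ * c)⁻¹) * c) * c := by positivity
  have hDr := hasMajorant_of_read hG hCn' hRD
  have hDr1 := hasMajorant_of_read hG hCn' hRD1
  -- the constants: κ_𝔖 ≦ κ_S and (1 − q)⁻¹ ≦ 2
  have hk1 : 𝔖.κ * CR * (A₀ * (1 - 𝔖.κ * θ * c)⁻¹) * c ≤ 2 * κS * CR * A₀ * c := by
    have h1 : A₀ * (1 - 𝔖.κ * θ * c)⁻¹ ≤ A₀ * 2 := mul_le_mul_of_nonneg_left hinv hA₀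
    calc 𝔖.κ * CR * (A₀ * (1 - 𝔖.κ * θ * c)⁻¹) * c ≤ κS * CR * (A₀ * 2) * c := by gcongr
      _ = 2 * κS * CR * A₀ * c := by ring
  have hk2 : 𝔖.κ * CR * (𝔖.κ * θ * (A₀ * (1 - 𝔖.κ * θ * c)⁻¹) * c) * c ≤ 2 * κS * κS * CR * A₀ * c * c * θ := by
    have h1 : A₀ * (1 - 𝔖.κ * θ * c)⁻¹ ≤ A₀ * 2 := mul_le_mul_of_nonneg_left hinv hA₀
    calc 𝔖.κ * CR * (𝔖.κ * θ * (A₀ * (1 - 𝔖.κ * θ * c)⁻¹) * c) * c ≤ κS * CR * (κS * θ * (A₀ * 2) * c) * c := by gcongr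
      _ = 2 * κS * κS * CR * A₀ * c * c * θ := by ring
  have hmono : ∀ {C C' : ℝ}, C ≤ C' → ∀ a b : g.Site, C * g.len a ^ 2 * Real.exp (-(δ * g.dist a b)) ≤ C' * g.len a ^ 2 * Real.exp (-(δ * g.dist a b)) :=
    fun h a b => mul_le_mul_of_nonneg_right (mul_le_mul_of_nonneg_right h (sq_nonneg _)) (Real.exp_nonneg _)
  exact ⟨hasMajorant_mono (g := toB6 g R₀ H₀) _ hG' (hmono hk1), hasMajorant_mono (g := toB6 g R₀ H₀) _ hG1' (hmono hk1),
    hasMajorant_mono (g := toB6 g R₀ H₀) _ hDr (hmono hk2), hasMajorant_mono (g := toB6 g R₀ H₀) _ hDr1 (hmono hk2)⟩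

end OneMember

/-! ## §2 ★★ The families at the pins of the class-parametric carrier -/

section Family

variable {𝔸 : Type} [NormedRing 𝔸] [NormedAlgebra ℂ 𝔸]
variable {κ : Type} [Fintype κ] [DecidableEq κ]
variable {d ℓ : ℕ} {hd : 1 ≤ d + 1} {hL : Odd (ℓ + 1) ∧ 1 < ℓ + 1} {b₀ b₁ : ℝ} {Mstar : ℕ}
variable [CompleteSpace 𝔸] [FiniteDimensional ℝ 𝔸] {G : Subgroup 𝔸ˣ}
variable (R₁ R₂ : RegFamY d ℓ hd hL b₀ b₁ Mstar 𝔸)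
variable {Y Z W : MemberY d ℓ hd hL b₀ b₁ Mstar → Type} [∀ x, Fintype (Z x)] [∀ x, Fintype (W x)]

/-- a small product: `0 ≤ t`, `m ≤ (2(t+1))⁻¹` ⇒ `t·m ≤ ½`. [folklore] -/
private theorem small_aux {t m : ℝ} (ht : 0 ≤ t) (hm : m ≤ (2 * (t + 1))⁻¹) : t * m ≤ 1 / 2 := by
  have h1 : t * m ≤ t * (2 * (t + 1))⁻¹ := mul_le_mul_of_nonneg_left hm ht
  have h2 : t * (2 * (t + 1))⁻¹ ≤ 1 / 2 := by
    rw [← div_eq_mul_inv, div_le_iff₀ (by positivity)]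
    nlinarith
  exact h1.trans h2

omit [DecidableEq κ] in
/-- ★★ **THE FOUR FAMILIES OF (2.51) MAJORANTS FROM THE STATE TUPLE AT THE PINS** — the state-class twin of `B9Eq3132DecayFromMajorantR.majorants_of_step12_R` and
`B9Eq3132CoerciveFromGAR.subMajorants_of_step12_R`: at the coordinate pins (`blk = blkBK bI`, `G ∕ G1 ∕ G0 = GcoK … (T ∕ T₁ ∕ T₀) U`), the STATE TUPLE `hstate` (the step
`StepS (𝔬 x) (𝔖 x U) (θ_S·Mα₀) δ_K U`, the producer `G₀ : 𝔠⁽⁰⁾ → 𝔖` (A₀e^{−δ_P d}), the reading `id : 𝔖 → 𝔠^{(−2)}` (C_Re^{−δ_P d}), `κ ≦ κ_S`, the ℓ¹-domination, the identities —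
conjuncts of the S-leaves' `hstate2`) and [4] (2.61) (`rowSum261_geo9Y`, σ > 0) give, above `max(M₁, M_L)` and for `Mα₀ ≤ min(a₁, (2(κ_Sθ_Sc+1))⁻¹)`, the majorants
`C₁(Lʲη)²e^{−δd}` of the models of `T`, `T₁` and `C₂·(Mα₀)·(Lʲη)²e^{−δd}` of `T − T₀`, `T₁ − T₀` (any 0 < δ with δ + 2σ ≦ δ_K, δ + σ ≦ δ_P).
[cite: Balaban1985BackgroundPropagators, Thm 3.12 p.423, (3.130) p.421, (3.138) p.423, (3.132) p.422; Balaban1984PropagatorsII, (2.51)–(2.54) pp.232–233, Lemma 2.1 (2.61) p.234] -/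
theorem majorants4_of_stepS_R [∀ x : MemberY d ℓ hd hL b₀ b₁ Mstar, Fintype (geo9Y x).Site] (bK : Module.Basis κ ℝ 𝔸) {c35 : ℝ}
    (𝔬 : ∀ x : MemberY d ℓ hd hL b₀ b₁ Mstar, Ops (geo9Y x) (bg9YR 𝔸 G R₁ R₂ x) (XBK κ x.toKIdx) (Y x) (Z x) (W x))
    (H₀ : MemberY d ℓ hd hL b₀ b₁ Mstar → Prop) (T T₁ T₀ : ∀ x : MemberY d ℓ hd hL b₀ b₁ Mstar, BondOpY 𝔸 x.toKIdx)
    {bI : ∀ x : MemberY d ℓ hd hL b₀ b₁ Mstar, FBondY x.toKIdx → IBondY x.toKIdx}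
    (hblk : ∀ x, (𝔬 x).blk = blkBK x.toKIdx (bI x))
    (hGco : ∀ (x : MemberY d ℓ hd hL b₀ b₁ Mstar) (U : (bg9YR 𝔸 G R₁ R₂ x).Cfg), (𝔬 x).G U = GcoK x.toKIdx bK (bg9YR 𝔸 G R₁ R₂ x) (fun U => U) (T x) U)
    (hG1co : ∀ (x : MemberY d ℓ hd hL b₀ b₁ Mstar) (U : (bg9YR 𝔸 G R₁ R₂ x).Cfg), (𝔬 x).G1 U = GcoK x.toKIdx bK (bg9YR 𝔸 G R₁ R₂ x) (fun U => U) (T₁ x) U)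
    (hG0co : ∀ (x : MemberY d ℓ hd hL b₀ b₁ Mstar) (U : (bg9YR 𝔸 G R₁ R₂ x).Cfg), (𝔬 x).G0 U = GcoK x.toKIdx bK (bg9YR 𝔸 G R₁ R₂ x) (fun U => U) (T₀ x) U)
    (𝔖 : ∀ x : MemberY d ℓ hd hL b₀ b₁ Mstar, (bg9YR 𝔸 G R₁ R₂ x).Cfg → BlockNorm (toB6 (geo9Y x) 1 (H₀ x)) (XBK κ x.toKIdx → ℝ))
    (θS A₀ CR κS δK δP σ δ a₁ M₁ : ℝ) (hθS : 0 ≤ θS) (hA₀ : 0 ≤ A₀) (hCR : 0 ≤ CR) (hκS : 0 ≤ κS) (hσ : 0 < σ) (hδ : 0 < δ) (hδK : δ + 2 * σ ≤ δK) (hδP : δ + σ ≤ δP)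
    (ha₁ : 0 < a₁) (hM₁ : 0 < M₁) (hgeo : ∀ x : MemberY d ℓ hd hL b₀ b₁ Mstar, GeoOK (geo9Y x))
    (hstate : ∀ x : MemberY d ℓ hd hL b₀ b₁ Mstar, M₁ ≤ (geo9Y x).M → ∀ α₀ : ℝ, 0 < α₀ → (geo9Y x).M * α₀ ≤ a₁ →
      ∀ U : (bg9YR 𝔸 G R₁ R₂ x).Cfg, (bg9YR 𝔸 G R₁ R₂ x).Reg335 c35 α₀ U → (bg9YR 𝔸 G R₁ R₂ x).Reg336 c35 α₀ U →
        StepS (𝔬 x) (𝔖 x U) (θS * ((geo9Y x).M * α₀)) δK U ∧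
        HasMaj (cNorm 1 (H₀ x) (𝔬 x).blk (hgeo x).lenle 0) (𝔖 x U) ((𝔬 x).G0 U) (fun a b => A₀ * Real.exp (-(δP * (geo9Y x).dist a b))) ∧
        HasMaj (𝔖 x U) (cNormR 1 (H₀ x) (𝔬 x).blk (hgeo x).lenle (-2)) LinearMap.id (fun a b => CR * Real.exp (-(δP * (geo9Y x).dist a b))) ∧
        (𝔖 x U).κ ≤ κS ∧ (∃ Λ : ℝ, 0 ≤ Λ ∧ ∀ (y : (geo9Y x).Site) (F : XBK κ x.toKIdx → ℝ), (𝔖 x U).loc y F ≤ Λ * ∑ q : XBK κ x.toKIdx, |F q|) ∧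
        Identities (𝔬 x) U) :
    ∃ M₂ a₂ C₁ C₂ : ℝ, 0 < M₂ ∧ 0 < a₂ ∧ 0 ≤ C₁ ∧ 0 ≤ C₂ ∧
      ∀ x : MemberY d ℓ hd hL b₀ b₁ Mstar, M₂ ≤ (geo9Y x).M → ∀ α₀ : ℝ, 0 < α₀ → (geo9Y x).M * α₀ ≤ a₂ →
        ∀ U : (bg9YR 𝔸 G R₁ R₂ x).Cfg, (bg9YR 𝔸 G R₁ R₂ x).Reg335 c35 α₀ U → (bg9YR 𝔸 G R₁ R₂ x).Reg336 c35 α₀ U →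
          HasMajorant (g := toB6 (geo9Y x) 1 (H₀ x)) (blkBK x.toKIdx (bI x)) (GcoK x.toKIdx bK (bg9YR 𝔸 G R₁ R₂ x) (fun U => U) (T x) U)
              (fun a a' => C₁ * (geo9Y x).len a ^ 2 * Real.exp (-(δ * (geo9Y x).dist a a'))) ∧
            HasMajorant (g := toB6 (geo9Y x) 1 (H₀ x)) (blkBK x.toKIdx (bI x)) (GcoK x.toKIdx bK (bg9YR 𝔸 G R₁ R₂ x) (fun U => U) (T₁ x) U)
              (fun a a' => C₁ * (geo9Y x).len a ^ 2 * Real.exp (-(δ * (geo9Y x).dist a a'))) ∧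
            HasMajorant (g := toB6 (geo9Y x) 1 (H₀ x)) (blkBK x.toKIdx (bI x)) (GcoK x.toKIdx bK (bg9YR 𝔸 G R₁ R₂ x) (fun U => U) (T x - T₀ x) U)
              (fun a a' => C₂ * ((geo9Y x).M * α₀) * (geo9Y x).len a ^ 2 * Real.exp (-(δ * (geo9Y x).dist a a'))) ∧
            HasMajorant (g := toB6 (geo9Y x) 1 (H₀ x)) (blkBK x.toKIdx (bI x)) (GcoK x.toKIdx bK (bg9YR 𝔸 G R₁ R₂ x) (fun U => U) (T₁ x - T₀ x) U)
              (fun a a' => C₂ * ((geo9Y x).M * α₀) * (geo9Y x).len a ^ 2 * Real.exp (-(δ * (geo9Y x).dist a a'))) := by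
  -- (2.61) for the record geometry at rate σ, constant `max c 0`
  obtain ⟨ML, c, hrow0⟩ := rowSum261_geo9Y (d := d) (ℓ := ℓ) (hd := hd) (hL := hL) (b₀ := b₀) (b₁ := b₁) (Mstar := Mstar) σ hσ
  set c' : ℝ := max c 0 with hc'
  have hc'0 : 0 ≤ c' := le_max_right _ _
  have hrow : ∀ x : MemberY d ℓ hd hL b₀ b₁ Mstar, ML ≤ (geo9Y x).M → RowSum (toB6 (geo9Y x) 1 (H₀ x)) σ c' :=
    fun x hM y => (hrow0 x hM y).trans (le_max_left _ _)
  set a₂ : ℝ := min a₁ (2 * (κS * θS * c' + 1))⁻¹ with ha₂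
  have ha₂0 : 0 < a₂ := lt_min ha₁ (inv_pos.2 (by positivity))
  refine ⟨max M₁ ML, a₂, 2 * κS * CR * A₀ * c', 2 * κS * κS * CR * A₀ * c' * c' * θS, lt_of_lt_of_le hM₁ (le_max_left _ _), ha₂0, by positivity, by positivity,
    fun x hM α₀ hα₀ hMa U hU hU' => ?_⟩
  have hM1 : M₁ ≤ (geo9Y x).M := (le_max_left _ _).trans hM
  have hMLx : ML ≤ (geo9Y x).M := (le_max_right _ _).trans hM
  have hMa1 : (geo9Y x).M * α₀ ≤ a₁ := hMa.trans (min_le_left _ _)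
  obtain ⟨hS, hP, hRd, hκ, ⟨Λ, hΛ, hdom⟩, hI⟩ := hstate x hM1 α₀ hα₀ hMa1 U hU hU'
  have hMα0 : 0 ≤ (geo9Y x).M * α₀ := mul_nonneg (hM₁.le.trans hM1) hα₀.le
  have hsmall : κS * (θS * ((geo9Y x).M * α₀)) * c' ≤ 1 / 2 := by
    have h := small_aux (t := κS * θS * c') (m := (geo9Y x).M * α₀) (by positivity) (hMa.trans (min_le_right _ _))
    calc κS * (θS * ((geo9Y x).M * α₀)) * c' = κS * θS * c' * ((geo9Y x).M * α₀) := by ring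
      _ ≤ 1 / 2 := h
  obtain ⟨h1, h2, h3, h4⟩ := hasMajorant_entries_of_stepS (hgeo x) (𝔬 x) (hrow x hMLx) (mul_nonneg hθS hMα0) hA₀ hCR hκS hδ.le hδK hδP hσ.le hc'0 hsmall
    hS hP hRd hκ hΛ hdom hI
  rw [hblk x] at h1 h2 h3 h4
  rw [hGco x U] at h1
  rw [hG1co x U] at h2
  rw [hGco x U, hG0co x U, ← GcoK_sub] at h3
  rw [hG1co x U, hG0co x U, ← GcoK_sub] at h4
  have he : ∀ a a' : (geo9Y x).Site, 2 * κS * κS * CR * A₀ * c' * c' * (θS * ((geo9Y x).M * α₀)) * (geo9Y x).len a ^ 2 * Real.exp (-(δ * (geo9Y x).dist a a')) =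
      2 * κS * κS * CR * A₀ * c' * c' * θS * ((geo9Y x).M * α₀) * (geo9Y x).len a ^ 2 * Real.exp (-(δ * (geo9Y x).dist a a')) := fun a a' => by ring
  exact ⟨h1, h2, hasMajorant_mono (g := toB6 (geo9Y x) 1 (H₀ x)) _ h3 fun a a' => le_of_eq (he a a'),
    hasMajorant_mono (g := toB6 (geo9Y x) 1 (H₀ x)) _ h4 fun a a' => le_of_eq (he a a')⟩

end Family

/-! ## §3 ★★★ ROW 26's faces from the state tuple (the twins of `B9Eq3132FacesAtLettersR` §3–§5) -/

section Faces

variable {κ : Type} [Fintype κ] [DecidableEq κ] {Ff : Type} [Fintype Ff] [DecidableEq Ff] {N : ℕ}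
variable (θ : Stage3Params) (Mstar : ℕ) (R₁ R₂ : RegFamY θ.d₆ θ.ℓ₆ θ.hd' θ.hL' θ.b₀ θ.b₁ Mstar (Matrix (Fin N) (Fin N) ℂ))
  (hG : MemOfFam (specialUnitaryUnits (Fin N)) R₁)
  [∀ x : MemberY θ.d₆ θ.ℓ₆ θ.hd' θ.hL' θ.b₀ θ.b₁ Mstar, Fintype (geo9Y x).Site] [∀ x : MemberY θ.d₆ θ.ℓ₆ θ.hd' θ.hL' θ.b₀ θ.b₁ Mstar, DecidableEq (geo9Y x).Site]
  {Y Z W : MemberY θ.d₆ θ.ℓ₆ θ.hd' θ.hL' θ.b₀ θ.b₁ Mstar → Type} [∀ x, Fintype (Z x)] [∀ x, Fintype (W x)]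
  (bK : Module.Basis κ ℝ (Matrix (Fin N) (Fin N) ℂ)) {c35 : ℝ}
  (𝔬 : ∀ x : MemberY θ.d₆ θ.ℓ₆ θ.hd' θ.hL' θ.b₀ θ.b₁ Mstar, Ops (geo9Y x) (bg9YR (Matrix (Fin N) (Fin N) ℂ) (specialUnitaryUnits (Fin N)) R₁ R₂ x) (XBK κ x.toKIdx) (Y x) (Z x) (W x))
  (H₀ : MemberY θ.d₆ θ.ℓ₆ θ.hd' θ.hL' θ.b₀ θ.b₁ Mstar → Prop)
  (T T₁ T₀ : ∀ x : MemberY θ.d₆ θ.ℓ₆ θ.hd' θ.hL' θ.b₀ θ.b₁ Mstar, BondOpY (Matrix (Fin N) (Fin N) ℂ) x.toKIdx)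
  (hT₀ : ∀ (x : MemberY θ.d₆ θ.ℓ₆ θ.hd' θ.hL' θ.b₀ θ.b₁ Mstar) (U : CfgY (Matrix (Fin N) (Fin N) ℂ) x.toKIdx), T₀ x U = Ring.inverse (deltaAY x.toKIdx (parSymY x.toKIdx) (parBY x.toKIdx) (GpY x.toKIdx (parSymY x.toKIdx)) U))
  {bI : ∀ x : MemberY θ.d₆ θ.ℓ₆ θ.hd' θ.hL' θ.b₀ θ.b₁ Mstar, FBondY x.toKIdx → IBondY x.toKIdx} (hblk : ∀ x, (𝔬 x).blk = blkBK x.toKIdx (bI x))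
  (hGco : ∀ (x : MemberY θ.d₆ θ.ℓ₆ θ.hd' θ.hL' θ.b₀ θ.b₁ Mstar) (U : (bg9YR (Matrix (Fin N) (Fin N) ℂ) (specialUnitaryUnits (Fin N)) R₁ R₂ x).Cfg), (𝔬 x).G U = GcoK x.toKIdx bK (bg9YR (Matrix (Fin N) (Fin N) ℂ) (specialUnitaryUnits (Fin N)) R₁ R₂ x) (fun U => U) (T x) U)
  (hG1co : ∀ (x : MemberY θ.d₆ θ.ℓ₆ θ.hd' θ.hL' θ.b₀ θ.b₁ Mstar) (U : (bg9YR (Matrix (Fin N) (Fin N) ℂ) (specialUnitaryUnits (Fin N)) R₁ R₂ x).Cfg), (𝔬 x).G1 U = GcoK x.toKIdx bK (bg9YR (Matrix (Fin N) (Fin N) ℂ) (specialUnitaryUnits (Fin N)) R₁ R₂ x) (fun U => U) (T₁ x) U)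
  (hG0co : ∀ (x : MemberY θ.d₆ θ.ℓ₆ θ.hd' θ.hL' θ.b₀ θ.b₁ Mstar) (U : (bg9YR (Matrix (Fin N) (Fin N) ℂ) (specialUnitaryUnits (Fin N)) R₁ R₂ x).Cfg), (𝔬 x).G0 U = GcoK x.toKIdx bK (bg9YR (Matrix (Fin N) (Fin N) ℂ) (specialUnitaryUnits (Fin N)) R₁ R₂ x) (fun U => U) (T₀ x) U)
  (hlev : ∀ (x : MemberY θ.d₆ θ.ℓ₆ θ.hd' θ.hL' θ.b₀ θ.b₁ Mstar) (f : FBondY x.toKIdx), lvl x.hN x.D x.hk (bI x f) = (blkV1 x.hN x.D f).1.1)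
  (hβ1 : ∀ (x : MemberY θ.d₆ θ.ℓ₆ θ.hd' θ.hL' θ.b₀ θ.b₁ Mstar) (f : FBondY x.toKIdx), (B6Geom246MultiLevelTorus.geomT x.D).dist (β x.hN x.D x.hk (bI x f)) (blkV1 x.hN x.D f) ≤ 1)
  {mN : ℕ} (hnbr : ∀ (x : MemberY θ.d₆ θ.ℓ₆ θ.hd' θ.hL' θ.b₀ θ.b₁ Mstar) (y : (geo9Y x).Site), (nbr (geo9Y x) ((θ.ℓ₆ : ℝ) + 4) y).card ≤ mN)
  (𝔖 : ∀ x : MemberY θ.d₆ θ.ℓ₆ θ.hd' θ.hL' θ.b₀ θ.b₁ Mstar, (bg9YR (Matrix (Fin N) (Fin N) ℂ) (specialUnitaryUnits (Fin N)) R₁ R₂ x).Cfg → BlockNorm (toB6 (geo9Y x) 1 (H₀ x)) (XBK κ x.toKIdx → ℝ))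
  (θS A₀ CR κS δK δP σ δ a₁ M₁ : ℝ) (hθS : 0 ≤ θS) (hA₀ : 0 ≤ A₀) (hCR : 0 ≤ CR) (hκS : 0 ≤ κS) (hσ : 0 < σ) (hδ : 0 < δ) (hδK : δ + 2 * σ ≤ δK) (hδP : δ + σ ≤ δP)
  (ha₁ : 0 < a₁) (hM₁ : 0 < M₁) (hgeo : ∀ x : MemberY θ.d₆ θ.ℓ₆ θ.hd' θ.hL' θ.b₀ θ.b₁ Mstar, GeoOK (geo9Y x))
  (a311 M311 : ℝ) (ha311 : 0 < a311) (hM311 : 0 < M311)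
  (hΔA : ∀ x : MemberY θ.d₆ θ.ℓ₆ θ.hd' θ.hL' θ.b₀ θ.b₁ Mstar, M311 ≤ (geo9Y x).M → ∀ α₀ : ℝ, 0 < α₀ → (geo9Y x).M * α₀ ≤ a311 → ∀ U : (bg9YR (Matrix (Fin N) (Fin N) ℂ) (specialUnitaryUnits (Fin N)) R₁ R₂ x).Cfg,
    (bg9YR (Matrix (Fin N) (Fin N) ℂ) (specialUnitaryUnits (Fin N)) R₁ R₂ x).Reg335 c35 α₀ U →
      PosDefTr (fun _ => (1 : ℝ)) (deltaAY x.toKIdx (parSymY x.toKIdx) (parBY x.toKIdx) (GpY x.toKIdx (parSymY x.toKIdx)) U))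
  {c' : ℝ}
  (hY : ∀ (x : MemberY θ.d₆ θ.ℓ₆ θ.hd' θ.hL' θ.b₀ θ.b₁ Mstar) (α₀ : ℝ) (U : CfgY (Matrix (Fin N) (Fin N) ℂ) x.toKIdx), R₁ x c35 α₀ U → R₂ x c35 α₀ U →
    regY335 (Matrix (Fin N) (Fin N) ℂ) (specialUnitaryUnits (Fin N)) x c' α₀ U ∧ regY336 (Matrix (Fin N) (Fin N) ℂ) (specialUnitaryUnits (Fin N)) x c' α₀ U)

include hblk hGco hG1co hG0co hθS hA₀ hCR hκS hσ hδ hδK hδP ha₁ hM₁ hlev hβ1 hnbr hG in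
/-- ★ **ROW 26's TWO DECAY BINDERS AT THE CARRIER FROM THE STATE TUPLE** — the twin of `B9Eq3132FacesAtLettersR.hdec26_of_step12_of_R` (`§2` + `hdec26_of_majorants_of_R`).
[cite: Balaban1985BackgroundPropagators, (3.132) p.422, Thm 3.12 pp.421–423, (3.130), (3.138), (3.35)–(3.36) p.396; Balaban1984PropagatorsII, (2.142) p.248, (2.51) p.232, Lemma 2.1 (2.60)–(2.61) p.234] -/
theorem hdec26_of_stepS_of_R
    (hstate : ∀ x : MemberY θ.d₆ θ.ℓ₆ θ.hd' θ.hL' θ.b₀ θ.b₁ Mstar, M₁ ≤ (geo9Y x).M → ∀ α₀ : ℝ, 0 < α₀ → (geo9Y x).M * α₀ ≤ a₁ →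
    ∀ U : (bg9YR (Matrix (Fin N) (Fin N) ℂ) (specialUnitaryUnits (Fin N)) R₁ R₂ x).Cfg,
      (bg9YR (Matrix (Fin N) (Fin N) ℂ) (specialUnitaryUnits (Fin N)) R₁ R₂ x).Reg335 c35 α₀ U → (bg9YR (Matrix (Fin N) (Fin N) ℂ) (specialUnitaryUnits (Fin N)) R₁ R₂ x).Reg336 c35 α₀ U →
        StepS (𝔬 x) (𝔖 x U) (θS * ((geo9Y x).M * α₀)) δK U ∧
        HasMaj (cNorm 1 (H₀ x) (𝔬 x).blk (hgeo x).lenle 0) (𝔖 x U) ((𝔬 x).G0 U) (fun a b => A₀ * Real.exp (-(δP * (geo9Y x).dist a b))) ∧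
        HasMaj (𝔖 x U) (cNormR 1 (H₀ x) (𝔬 x).blk (hgeo x).lenle (-2)) LinearMap.id (fun a b => CR * Real.exp (-(δP * (geo9Y x).dist a b))) ∧
        (𝔖 x U).κ ≤ κS ∧ (∃ Λ : ℝ, 0 ≤ Λ ∧ ∀ (y : (geo9Y x).Site) (F : XBK κ x.toKIdx → ℝ), (𝔖 x U).loc y F ≤ Λ * ∑ q : XBK κ x.toKIdx, |F q|) ∧
        Identities (𝔬 x) U)
    :
    DecayUnder c35 (fun x : MemberY θ.d₆ θ.ℓ₆ θ.hd' θ.hL' θ.b₀ θ.b₁ Mstar => geoComap (geo9Y x) (Prod.fst : (geo9Y x).Site × TrIdx N → (geo9Y x).Site))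
        (bg9YR (Matrix (Fin N) (Fin N) ℂ) (specialUnitaryUnits (Fin N)) R₁ R₂) (fun x U => normMatY (trBasis N) (lamInvY x.toKIdx) (QGQOfY x.toKIdx (parBY x.toKIdx) (T x) U)) ∧
      DecayUnder c35 (fun x : MemberY θ.d₆ θ.ℓ₆ θ.hd' θ.hL' θ.b₀ θ.b₁ Mstar => geoComap (geo9Y x) (Prod.fst : (geo9Y x).Site × TrIdx N → (geo9Y x).Site))
        (bg9YR (Matrix (Fin N) (Fin N) ℂ) (specialUnitaryUnits (Fin N)) R₁ R₂) (fun x U => normMatY (trBasis N) (lamInvY x.toKIdx) (QGQOfY x.toKIdx (parBY x.toKIdx) (T₁ x) U)) := by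
  obtain ⟨M₂, a₂, C₁, C₂, hM₂, ha₂, hC₁, -, hmaj⟩ := majorants4_of_stepS_R R₁ R₂ (G := specialUnitaryUnits (Fin N)) bK 𝔬 H₀ T T₁ T₀ hblk hGco hG1co hG0co 𝔖
    θS A₀ CR κS δK δP σ δ a₁ M₁ hθS hA₀ hCR hκS hσ hδ hδK hδP ha₁ hM₁ hgeo hstate
  exact hdec26_of_majorants_of_R θ Mstar R₁ R₂ hG bK (trBasis N) T T₁ hlev hβ1 hnbr (R := fun _ => 1)
    ⟨M₂, a₂, C₁, δ, hM₂, ha₂, hC₁, hδ, fun x hM α₀ hα₀ hMa U hU hU' =>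
      ⟨(hmaj x hM α₀ hα₀ hMa U hU hU').1, (hmaj x hM α₀ hα₀ hMa U hU hU').2.1⟩⟩

include hblk hGco hG1co hG0co hθS hA₀ hCR hκS hσ hδ hδK hδP ha₁ hM₁ hlev hβ1 hnbr hG hY hT₀ ha311 hM311 hΔA in
/-- ★★ **ROW 26's TWO COERCIVITY BINDERS AT THE CARRIER FROM ROW 17, A REFINEMENT OF MODULE 3's CLASS AND THE STATE TUPLE** — the twin of
`B9Eq3132FacesAtLettersR.hco26_of_refinesY_step12_of_R` (`§2` + `coerciveUnder_of_subMajorants_R` + `hcoA_of_refinesY_R`).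
[cite: Balaban1985BackgroundPropagators, (3.132) p.422, Thm 3.12 pp.421–423, Thm 3.11 p.416, (3.35)–(3.36) p.396, (3.69) p.404; Balaban1984PropagatorsII, (2.147) p.248] -/
theorem hco26_of_refinesY_stepS_of_R
    (hstate : ∀ x : MemberY θ.d₆ θ.ℓ₆ θ.hd' θ.hL' θ.b₀ θ.b₁ Mstar, M₁ ≤ (geo9Y x).M → ∀ α₀ : ℝ, 0 < α₀ → (geo9Y x).M * α₀ ≤ a₁ →
    ∀ U : (bg9YR (Matrix (Fin N) (Fin N) ℂ) (specialUnitaryUnits (Fin N)) R₁ R₂ x).Cfg,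
      (bg9YR (Matrix (Fin N) (Fin N) ℂ) (specialUnitaryUnits (Fin N)) R₁ R₂ x).Reg335 c35 α₀ U → (bg9YR (Matrix (Fin N) (Fin N) ℂ) (specialUnitaryUnits (Fin N)) R₁ R₂ x).Reg336 c35 α₀ U →
        StepS (𝔬 x) (𝔖 x U) (θS * ((geo9Y x).M * α₀)) δK U ∧
        HasMaj (cNorm 1 (H₀ x) (𝔬 x).blk (hgeo x).lenle 0) (𝔖 x U) ((𝔬 x).G0 U) (fun a b => A₀ * Real.exp (-(δP * (geo9Y x).dist a b))) ∧
        HasMaj (𝔖 x U) (cNormR 1 (H₀ x) (𝔬 x).blk (hgeo x).lenle (-2)) LinearMap.id (fun a b => CR * Real.exp (-(δP * (geo9Y x).dist a b))) ∧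
        (𝔖 x U).κ ≤ κS ∧ (∃ Λ : ℝ, 0 ≤ Λ ∧ ∀ (y : (geo9Y x).Site) (F : XBK κ x.toKIdx → ℝ), (𝔖 x U).loc y F ≤ Λ * ∑ q : XBK κ x.toKIdx, |F q|) ∧
        Identities (𝔬 x) U)
    :
    CoerciveUnder c35 (fun x : MemberY θ.d₆ θ.ℓ₆ θ.hd' θ.hL' θ.b₀ θ.b₁ Mstar => geoComap (geo9Y x) (Prod.fst : (geo9Y x).Site × TrIdx N → (geo9Y x).Site))
        (bg9YR (Matrix (Fin N) (Fin N) ℂ) (specialUnitaryUnits (Fin N)) R₁ R₂) (fun x U => normMatY (trBasis N) (lamInvY x.toKIdx) (QGQOfY x.toKIdx (parBY x.toKIdx) (T x) U)) ∧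
      CoerciveUnder c35 (fun x : MemberY θ.d₆ θ.ℓ₆ θ.hd' θ.hL' θ.b₀ θ.b₁ Mstar => geoComap (geo9Y x) (Prod.fst : (geo9Y x).Site × TrIdx N → (geo9Y x).Site))
        (bg9YR (Matrix (Fin N) (Fin N) ℂ) (specialUnitaryUnits (Fin N)) R₁ R₂) (fun x U => normMatY (trBasis N) (lamInvY x.toKIdx) (QGQOfY x.toKIdx (parBY x.toKIdx) (T₁ x) U)) := by
  have hparG : ∀ (x : MemberY θ.d₆ θ.ℓ₆ θ.hd' θ.hL' θ.b₀ θ.b₁ Mstar) (U : CfgY (Matrix (Fin N) (Fin N) ℂ) x.toKIdx), (∀ μ y, U μ y ∈ specialUnitaryUnits (Fin N)) →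
      ∀ s s', ‖(parBY x.toKIdx U s s' : Matrix (Fin N) (Fin N) ℂ)‖ ≤ 1 ∧ ‖(((parBY x.toKIdx U s s')⁻¹ : (Matrix (Fin N) (Fin N) ℂ)ˣ) : Matrix (Fin N) (Fin N) ℂ)‖ ≤ 1 :=
    fun x U hUG s s' => contractive_of_mem specialUnitaryUnits_le_unitaryUnits (parBY_mem x.toKIdx hUG s s')
  have hcoA := hcoA_of_refinesY_R θ Mstar R₁ R₂ hG hY T₀ hT₀ a311 M311 ha311 hM311 hΔA
  obtain ⟨M₂, a₂, C₁, C₂, hM₂, ha₂, -, hC₂, hmaj⟩ := majorants4_of_stepS_R R₁ R₂ (G := specialUnitaryUnits (Fin N)) bK 𝔬 H₀ T T₁ T₀ hblk hGco hG1co hG0co 𝔖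
    θS A₀ CR κS δK δP σ δ a₁ M₁ hθS hA₀ hCR hκS hσ hδ hδK hδP ha₁ hM₁ hgeo hstate
  exact ⟨coerciveUnder_of_subMajorants_R R₁ R₂ hG bK (trBasis N) T T₀ (fun x => parBY x.toKIdx) hparG hlev hβ1 hnbr (R := fun _ => 1) hcoA
      ⟨M₂, a₂, C₂, δ, hM₂, ha₂, hC₂, hδ, fun x hM α₀ hα₀ hMa U hU hU' => (hmaj x hM α₀ hα₀ hMa U hU hU').2.2.1⟩,
    coerciveUnder_of_subMajorants_R R₁ R₂ hG bK (trBasis N) T₁ T₀ (fun x => parBY x.toKIdx) hparG hlev hβ1 hnbr (R := fun _ => 1) hcoA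
      ⟨M₂, a₂, C₂, δ, hM₂, ha₂, hC₂, hδ, fun x hM α₀ hα₀ hMa U hU hU' => (hmaj x hM α₀ hα₀ hMa U hU hU').2.2.2⟩⟩

include hblk hGco hG1co hG0co hθS hA₀ hCR hκS hσ hδ hδK hδP ha₁ hM₁ hlev hβ1 hnbr hG hY hT₀ ha311 hM311 hΔA in
/-- ★★★ **ROW 26 OF THE R-GENERIC CERTIFICATE FROM THE STATE TUPLE, ROW 17 AND A REFINEMENT OF MODULE 3's CLASS** — the twin of
`B9Eq3132FacesAtLettersR.s3132Nu_opsYSectE_of_step12_R_of_refinesY` with `hmodel` replaced by `hstate`: for ANY letters family `𝔏` with `(QGQ*)⁻¹ ∕ (QG₁Q*)⁻¹ = Ring.inverse (Q T Q*)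
∕ (Q T₁ Q*)` (`hQ ∕ hQ₁`), `B9.Stmt3132Printed (d+1) c35 geo9Y (bg9YR … R₁ R₂)` for the two kernels read through `siteKernelR R₁ R₂`.
[cite: Balaban1985BackgroundPropagators, (3.132) p.422, Thm 3.12 pp.421–423, Thm 3.11 p.416, (3.35)–(3.36) p.396; Balaban1984PropagatorsII, (2.142) (2.147) p.248, Prop. 2.7 (2.149) p.249] -/
theorem s3132Nu_opsYSectE_of_stepS_R_of_refinesY
    (hstate : ∀ x : MemberY θ.d₆ θ.ℓ₆ θ.hd' θ.hL' θ.b₀ θ.b₁ Mstar, M₁ ≤ (geo9Y x).M → ∀ α₀ : ℝ, 0 < α₀ → (geo9Y x).M * α₀ ≤ a₁ →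
    ∀ U : (bg9YR (Matrix (Fin N) (Fin N) ℂ) (specialUnitaryUnits (Fin N)) R₁ R₂ x).Cfg,
      (bg9YR (Matrix (Fin N) (Fin N) ℂ) (specialUnitaryUnits (Fin N)) R₁ R₂ x).Reg335 c35 α₀ U → (bg9YR (Matrix (Fin N) (Fin N) ℂ) (specialUnitaryUnits (Fin N)) R₁ R₂ x).Reg336 c35 α₀ U →
        StepS (𝔬 x) (𝔖 x U) (θS * ((geo9Y x).M * α₀)) δK U ∧
        HasMaj (cNorm 1 (H₀ x) (𝔬 x).blk (hgeo x).lenle 0) (𝔖 x U) ((𝔬 x).G0 U) (fun a b => A₀ * Real.exp (-(δP * (geo9Y x).dist a b))) ∧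
        HasMaj (𝔖 x U) (cNormR 1 (H₀ x) (𝔬 x).blk (hgeo x).lenle (-2)) LinearMap.id (fun a b => CR * Real.exp (-(δP * (geo9Y x).dist a b))) ∧
        (𝔖 x U).κ ≤ κS ∧ (∃ Λ : ℝ, 0 ≤ Λ ∧ ∀ (y : (geo9Y x).Site) (F : XBK κ x.toKIdx → ℝ), (𝔖 x U).loc y F ≤ Λ * ∑ q : XBK κ x.toKIdx, |F q|) ∧
        Identities (𝔬 x) U)
    (𝔏 : LettersY N θ Mstar) (𝔈 : ExpsY N θ Mstar) (𝔢 : SectEY N θ Mstar) (𝔴 : RWEY N θ Mstar)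
    (hQ : ∀ x : MemberY θ.d₆ θ.ℓ₆ θ.hd' θ.hL' θ.b₀ θ.b₁ Mstar, (𝔏 x).QGQinv = fun U => Ring.inverse (QGQOfY x.toKIdx (parBY x.toKIdx) (T x) U))
    (hQ₁ : ∀ x : MemberY θ.d₆ θ.ℓ₆ θ.hd' θ.hL' θ.b₀ θ.b₁ Mstar, (𝔏 x).QG1Qinv = fun U => Ring.inverse (QGQOfY x.toKIdx (parBY x.toKIdx) (T₁ x) U)) :
    B9.Stmt3132Printed (θ.d₆ + 1) c35 (geo9Y (d := θ.d₆) (ℓ := θ.ℓ₆) (hd := θ.hd') (hL := θ.hL') (b₀ := θ.b₀) (b₁ := θ.b₁) (Mstar := Mstar))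
      (bg9YR (Matrix (Fin N) (Fin N) ℂ) (specialUnitaryUnits (Fin N)) R₁ R₂)
      (fun x => siteKernelR R₁ R₂ (opsYSectE N θ Mstar (opsYS349NuOfLetters N θ Mstar 𝔏 𝔈) 𝔏 𝔢 𝔴 x).QGQinv)
      (fun x => siteKernelR R₁ R₂ (opsYSectE N θ Mstar (opsYS349NuOfLetters N θ Mstar 𝔏 𝔈) 𝔏 𝔢 𝔴 x).QG1Qinv) := by
  obtain ⟨hdec, hdec₁⟩ := hdec26_of_stepS_of_R θ Mstar R₁ R₂ hG bK 𝔬 H₀ T T₁ T₀ hblk hGco hG1co hG0co hlev hβ1 hnbr 𝔖 θS A₀ CR κS δK δP σ δ a₁ M₁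
    hθS hA₀ hCR hκS hσ hδ hδK hδP ha₁ hM₁ hgeo hstate
  obtain ⟨hco, hco₁⟩ := hco26_of_refinesY_stepS_of_R θ Mstar R₁ R₂ hG bK 𝔬 H₀ T T₁ T₀ hT₀ hblk hGco hG1co hG0co hlev hβ1 hnbr 𝔖 θS A₀ CR κS δK δP σ δ a₁ M₁
    hθS hA₀ hCR hκS hσ hδ hδK hδP ha₁ hM₁ hgeo a311 M311 ha311 hM311 hΔA hY hstate
  exact s3132Nu_opsYSectE_of_ringInverse_R θ Mstar R₁ R₂ 𝔏 𝔈 𝔢 𝔴 (trBasis N) (fun x U => QGQOfY x.toKIdx (parBY x.toKIdx) (T x) U)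
    (fun x U => QGQOfY x.toKIdx (parBY x.toKIdx) (T₁ x) U) hQ hQ₁ hco hdec hco₁ hdec₁

end Faces

end Literature.MathematicalPhysics.QuantumFieldTheory.Balaban1983to89.B9Eq3132FromStateR

end
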